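import Summits.ABC.IUTFork.Joshi.ATS4Eq6811TowerGlue
import Summits.ABC.IUTFork.Joshi.ATS4RowsCEFReading3Genuine
import Literature.IUT.LogVolume.DistinguishedPrimesBoundGalois
import Literature.IUT.LogVolume.PilotDataBaseChange
import HarnessLib

/-!
# Joshi, *Arithmetic Teichmüller Spaces IV* (arXiv:2403.10430v2) §6.6–§6.7: the tower of primes `PrimeTowerDatum` READ GENUINELY at
# a tower of number fields — the DEFINITION-lane constructor, and what becomes a THEOREM under it

DEFINITION-lane companion of the abc-iut cell, branch E «type Joshi's construction, test vs S» / R-J «Joshi Y-discharge census»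
(rung LADDER-ABC:A2.RESCUE.J), seat abc-iut-E-t31 (gen 4; AUTHORS-FIRST on the seat's own slot [A] =
`Joshi/ATS4RamificationDivisors.lean` p430536, which stays byte-identical — DEFS-FREEZE). It supplies the one object two seats
left open BY NAME: «a DEFINITION-lane genuine `PrimeTowerDatum` constructor at number fields (then `hT` is a theorem, not a
hypothesis)» (abc-iut-E-t24 gen 9, closing line of p465152) = «genuine `PrimeTowerDatum` at a number-field tower (slot [A]) so that
`TowerGlue.eq6811_of_genuineTower` fires witness-free» (E-t31 gen 3, plan/E/t31/README). SOURCE: K. Joshi, *Construction of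
Arithmetic Teichmüller Spaces IV*, arXiv:2403.10430v2 (unrefereed preprint; bib `Joshi2024ATS4`); page/line = the cell's render
`HOME/lit/renders/Joshi-arxiv-2403.10430/pNNNN.txt` («p.N l.M» = line M of page N).

FRAMING (binding): NO side is taken on [IUTchIII] Cor. 3.12 / [IUTchIV] Thm. 1.10, on Joshi's claims, or on Mochizuki's report on
them; NOT a test verdict; NOT an abc claim; typed ≠ proved ≠ endorsed. One `def` (a constructor of the landed SIGNATURE; no new
`Prop`, no instance, no notation) and theorems of classical algebraic number theory + bookkeeping; standard axioms; FACT rows: none.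

## What the source prints (the slots being read)

* §6.6 p.60 l.56–62: «Suppose L_mod ⊆ L_tpd ⊆ M ⊆ L′ … Consider a subset of primes V^dst_M ⊂ V^non_M such that v ∈ V^dst_M, if and
  only if, v extends to a prime of L′ which is ramified over ℚ.» Lemma 6.6.1 p.60 l.63 – p.61 l.12: «TFAE (1) v ∈ V^dst_M … (3) The
  image of v ∈ V_{L_tpd} is contained in V^dst_{L_tpd}. In particular V^dst_M … is finite.»
* §6.7 p.61 l.14–30: «V^dst_{L_mod} … (resp. V^dst_ℚ …) the images of V^dst_{L_tpd}»; Lemma 6.7.1 «(1) v_ℚ ∈ V^dst_ℚ. (2) v_ℚ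
  ramifies in L′.»; (6.7.2)–(6.7.4) `s_{L*} = Σ_{v ∈ V^dst_{L*}} e_v·v`, `log(s_ℚ) = Σ_{p ∈ V^dst_ℚ} log p` ((6.8.12) p.64 l.4–13).
* §4.3 (4.3.1)–(4.3.2) p.39 l.40–48: «d_M = Σ_{w ∈ V_M} ord_w(d_{M,w})·w, d_{M,w} = ord_w(diff_{O_{L,w}/ℤ_p})» — the ABSOLUTE different;
  §4.4 p.40 l.35–40 + Def. 4.4.2 p.40 l.48–57: «V^{odd,ss}_M the inverse image of the set of primes V_{L_mod} … q_M = Σ_{w ∈ V^{odd,ss}_M}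
  ord_w(q_w)·w» — the Tate divisor is supported on the INVERSE IMAGE of a set of primes of `L_mod`;
  §4.4 p.40 l.33: «e_w the absolute ramification degree of M_w/ℚ_p»; p.62 l.56–58 «log v = f_v·log(p_v)».

## What this file adds

1. `PrimeTowerDatum.ofNumberFields Lmod Ltpd M L L' S e* ℓ` (§1): the signature p430536 READ at number fields
   `L_mod ⊆ L_tpd ⊆ M ⊆ L′`, `L_tpd ⊆ L ⊆ L′`: prime types := the finite places `HeightOneSpectrum (𝓞 ·)`; restrictions := the
   tree's `finBelow` («w ∩ 𝓞_X»), the two routes to `L_tpd` agreeing by `finBelow_finBelow`; `p_v := residueChar`; `Ramified :=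
   {w : e(w|p_w) ≥ 2}` — its finiteness («only finitely many primes of L′ ramify», carried as a FIELD of the signature) is now PROVED
   (`p_w ∣ disc L′` by Dedekind, finitely many places over each `p`); `Supp(q_X + d_X) :=` (inverse image of `S = Supp q_{L_mod}`,
   Def. 4.4.2) `∪ Supp d_X` ((4.3.1): `ord_u 𝔡_{X/ℚ} > 0`); `e_u`, `e_v`, `f_v` := Mathlib's absolute `ramificationIdx ℤ` /
   `inertiaDeg ℤ`; `d_mod := [L_mod : ℚ]`; `e*_mod`, `ℓ` stay parameters (§4.1.1 (5) is slot T-30's object, glued by name).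
2. THEOREMS over the genuine tower (§2–§4): residue characteristics are prime (E-t24's hypothesis `hc`); `charW = residueChar L′`;
   **`p ∈ V^dst_ℚ ⟺ ∃ u ∈ 𝕍(L′), p_u = p ∧ e(u|p) ≥ 2`** — VERBATIM the hypothesis `hT` of p465152 (E-t24 gen 9), now a theorem;
   `V^dst_ℚ = primeFactors(disc L′)` as finite sets (Lemma 6.7.1 (1) ⟺ (2) ⟺ «p ∣ disc L′», Dedekind); `log(s_ℚ) = Σ_{p ∣ disc L′} log p`;
   the level-wise readings of `V^dst_M`, `V^dst_{L_tpd}`, `V^dst_{L_mod}`; `Supp d_X ⟺ ramified` (Dedekind's «a prime divides the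
   different iff it ramifies», tree pair); «v ∈ Supp(d_M) ⟹ v ∈ V^dst_M» (the different-half of Lemma 6.6.1 (2) ⟹ (1): `e(w|p) =
   e(v|p)·e(w|v)`).
3. **Lemma 6.6.1 (1) ⟺ (3) DERIVED** at the genuine tower whenever `L′/L_tpd` is Galois (§3; registry row J4:Lem6.6.1 carried
   «(3) ⟹ (1)» as a HYPOTHESIS over the signature): conjugate places of a Galois extension ramify together (tree
   `ramificationIdx_int_eq_of_finBelow_eq`) + going-up. In the standing set-up the hypothesis is met: §6.6 itself assumes
   «M/L_mod Galois», and under the cell's dictionary `L′ ↔ K`, `L_mod ↔ F_mod` [IUTchI] Rmk. 3.1.5 reads «K is Galois over F_mod»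
   (so `L′/L_tpd` is Galois); NOTHING is claimed without the hypothesis.
4. The two consumers DISCHARGED (§4): E-t24's `TowerGlue.eq6811_of_genuineTower` (p453374's (6.8.11) = R-J row Y-21f) with `hc`,
   `hW` gone — `TowerGlue.eq6811_ofNumberFields`; E-t24 gen 9's `TowerGlue.vdst_eq_primeFactors_discr` /
   `vdst_eq_reading3_iff_of_genuine` (rows Y-21c/e/f) with `hT` gone — `…_ofNumberFields`. §5: the constructor elaborates at the
   trivial tower `ℚ = ℚ = ℚ = ℚ = ℚ` with `V^dst_ℚ = ∅` (`disc ℚ = 1`) — a smoke test of the definition, nothing more.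

RUNG CURRENCY: no census count moves; the «for a genuine instantiation» provisos of Y-21f (E-t24 INFO-1) and Y-21c/e/f (p465152
`hT`) are removed for towers built by `ofNumberFields`. [claim: Joshi2024ATS4, status: disputed] for every locator / reading;
the mathematics is [cite: NeukirchANT1999, Ch. I (9.3), Ch. III (2.6), (2.12)] + bookkeeping.
-/

noncomputable section

open NumberField IsDedekindDomain Finset
open Literature.IUT.LogVolume

namespace Summit.ABC.IUTFork.Joshi.ATS4

namespace PrimeTowerDatum

/-! ## 0. Dedekind: «a prime divides the different iff it is ramified» at a finite place (tree pair, composed) -/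

/-- **`ord_u 𝔡_{X/ℚ} > 0 ⟺ e(u|p_u) ≥ 2`** for a finite place `u` of a number field `X`: Supp of the absolute different (4.3.1) =
the places ramified over `ℚ`. Composition of the tree's `two_le_ramificationIdx_int_of_multiplicity_pos` (⟹) and
`ramificationIdx_int_sub_one_le_multiplicity` (`e − 1 ≤ ord_u 𝔡`, ⟸). [cite: NeukirchANT1999, Ch. III (2.6)] -/
theorem multiplicity_differentIdeal_pos_iff_two_le {X : Type*} [Field X] [NumberField X] (u : HeightOneSpectrum (𝓞 X)) :
    0 < multiplicity u.asIdeal (differentIdeal ℤ (𝓞 X)) ↔ 2 ≤ u.asIdeal.ramificationIdx ℤ := by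
  refine ⟨two_le_ramificationIdx_int_of_multiplicity_pos u, fun h => ?_⟩
  have h1 := ramificationIdx_int_sub_one_le_multiplicity u
  omega

/-! ## 1. The constructor: `PrimeTowerDatum` read at a tower of number fields -/

section Constructor

variable (Lmod Ltpd M L L' : Type) [Field Lmod] [NumberField Lmod] [Field Ltpd] [NumberField Ltpd]
  [Field M] [NumberField M] [Field L] [NumberField L] [Field L'] [NumberField L']
  [Algebra Lmod Ltpd] [Algebra Ltpd M] [Algebra M L'] [Algebra Ltpd L] [Algebra L L'] [Algebra Ltpd L']
  [IsScalarTower Ltpd M L'] [IsScalarTower Ltpd L L']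
  (S : Finset (HeightOneSpectrum (𝓞 Lmod))) (estar l : ℕ)

/-- **Only finitely many finite places of a number field are ramified over `ℚ`** («only finitely many primes of L′ ramify» — the
field `ramified_finite` of the signature, p.61 l.6–7 «In particular V^dst_M … is finite»): a ramified `w` has `p_w ∣ disc L′`
(Dedekind, E-t35's `GenuineVdst.residueChar_mem_primeFactors_discr`) and lies in the finite fibre `placesOver L′ p_w`.
[cite: NeukirchANT1999, Ch. III (2.12)] -/
theorem setOf_two_le_ramificationIdx_finite :
    {w : HeightOneSpectrum (𝓞 L') | 2 ≤ w.asIdeal.ramificationIdx ℤ}.Finite := by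
  classical
  refine (((Int.natAbs (discr L')).primeFactors.biUnion fun p => placesOver L' p).finite_toSet).subset fun w hw => ?_
  rw [Finset.mem_coe, Finset.mem_biUnion]
  haveI : Fact (residueChar L' w).Prime := ⟨residueChar_prime L' w⟩
  exact ⟨residueChar L' w, GenuineVdst.residueChar_mem_primeFactors_discr w hw, (mem_placesOver_iff_residueChar w).mpr rfl⟩

/-- **Joshi's tower of primes READ GENUINELY at number fields `L_mod ⊆ L_tpd ⊆ M ⊆ L′`, `L_tpd ⊆ L ⊆ L′`** (§4.1.2 (8)(9), §6.6
p.60 l.56–62, §6.7 p.61 l.14–21, §4.3–4.4 p.39 l.40 – p.40 l.57, p.62 l.56–58): every prime type is the type of finite places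
`HeightOneSpectrum (𝓞 ·)`; the restriction maps are `w ↦ w ∩ 𝓞_X` (`finBelow`); `p_v = residueChar`; the ramified primes of `L′`
are `{w : e(w|p_w) ≥ 2}` (finite — PROVED); `Supp(q_X + d_X)` is «`X`-place over the set `S` of primes of `L_mod`» (Def. 4.4.2:
the Tate divisor is supported on the inverse image of a set of primes of `L_mod`; `S` = that set) «or `ord 𝔡_{X/ℚ} > 0`» ((4.3.1));
`e_u`, `e_v`, `f_v` are the absolute ramification indices / residue degrees; `d_mod = [L_mod : ℚ]`; `e*_mod` and `ℓ` are free
parameters (objects of §4.1.1 (5) / Thm 6.1.1, glued by name elsewhere). A constructor of the SIGNATURE p430536 — the paper's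
assertions stay the reading predicates of that file. [claim: Joshi2024ATS4, status: disputed] -/
def ofNumberFields : PrimeTowerDatum where
  W := HeightOneSpectrum (𝓞 L')
  PM := HeightOneSpectrum (𝓞 M)
  PL := HeightOneSpectrum (𝓞 L)
  Ptpd := HeightOneSpectrum (𝓞 Ltpd)
  Pmod := HeightOneSpectrum (𝓞 Lmod)
  resM := finBelow M L'
  resL := finBelow L L'
  MtoTpd := finBelow Ltpd M
  LtoTpd := finBelow Ltpd L
  tpdToMod := finBelow Lmod Ltpd
  res_comm := fun w => (finBelow_finBelow Ltpd M L' w).trans (finBelow_finBelow Ltpd L L' w).symm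
  char := residueChar Lmod
  Ramified := {w | 2 ≤ w.asIdeal.ramificationIdx ℤ}
  ramified_finite := setOf_two_le_ramificationIdx_finite L'
  suppM := {u | finBelow Lmod Ltpd (finBelow Ltpd M u) ∈ S ∨ 0 < multiplicity u.asIdeal (differentIdeal ℤ (𝓞 M))}
  suppTpd := {u | finBelow Lmod Ltpd u ∈ S ∨ 0 < multiplicity u.asIdeal (differentIdeal ℤ (𝓞 Ltpd))}
  suppL := {u | finBelow Lmod Ltpd (finBelow Ltpd L u) ∈ S ∨ 0 < multiplicity u.asIdeal (differentIdeal ℤ (𝓞 L))}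
  eM := fun u => u.asIdeal.ramificationIdx ℤ
  eMod := fun v => v.asIdeal.ramificationIdx ℤ
  fMod := fun v => v.asIdeal.inertiaDeg ℤ
  dmod := Module.finrank ℚ Lmod
  estar := estar
  l := l

/-! ## 2. The slots, read back -/

/-- The `ℓ`-slot is the parameter `ℓ`. [folklore] -/
theorem ofNumberFields_l : (ofNumberFields Lmod Ltpd M L L' S estar l).l = l := rfl
/-- The `e*_mod`-slot is the parameter `e*`. [folklore] -/
theorem ofNumberFields_estar : (ofNumberFields Lmod Ltpd M L L' S estar l).estar = estar := rfl

/-- `d_mod = [L_mod : ℚ]` (§4.1.1 (2)). [claim: Joshi2024ATS4, status: disputed] -/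
theorem ofNumberFields_dmod : (ofNumberFields Lmod Ltpd M L L' S estar l).dmod = Module.finrank ℚ Lmod := rfl

/-- `p_v` of a prime of `L_mod` is its residue characteristic. [claim: Joshi2024ATS4, status: disputed] -/
theorem ofNumberFields_char (v : HeightOneSpectrum (𝓞 Lmod)) :
    (ofNumberFields Lmod Ltpd M L L' S estar l).char v = residueChar Lmod v := rfl

/-- The ramified slot: `w ∈ Ramified ⟺ e(w|p_w) ≥ 2`. [claim: Joshi2024ATS4, status: disputed] -/
theorem mem_ramified_ofNumberFields_iff (w : HeightOneSpectrum (𝓞 L')) :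
    w ∈ (ofNumberFields Lmod Ltpd M L L' S estar l).Ramified ↔ 2 ≤ w.asIdeal.ramificationIdx ℤ := Iff.rfl

/-- **Residue characteristics are prime** — the hypothesis `hc` of E-t24's `TowerGlue.vdst_prime` / `eq6811_of_genuineTower` and of
E-t31's `prime_of_mem_vdstQ`, now a theorem (p.65 l.31). [folklore] -/
theorem char_prime_ofNumberFields (v : (ofNumberFields Lmod Ltpd M L L' S estar l).Pmod) :
    ((ofNumberFields Lmod Ltpd M L L' S estar l).char v).Prime :=
  residueChar_prime Lmod v

/-- `p_u` of a prime `u` of `L_tpd` read through the tower (`charTpd = char ∘ tpdToMod`) is its own residue characteristic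
(`residueChar_finBelow`). [claim: Joshi2024ATS4, status: disputed] -/
theorem charTpd_ofNumberFields (u : HeightOneSpectrum (𝓞 Ltpd)) :
    (ofNumberFields Lmod Ltpd M L L' S estar l).charTpd u = residueChar Ltpd u :=
  residueChar_finBelow (F := Lmod) u

/-- `p_u` of a prime `u` of `M` read through the tower is its residue characteristic. [claim: Joshi2024ATS4, status: disputed] -/
theorem charM_ofNumberFields (u : HeightOneSpectrum (𝓞 M)) :
    (ofNumberFields Lmod Ltpd M L L' S estar l).charM u = residueChar M u :=
  (charTpd_ofNumberFields Lmod Ltpd M L L' S estar l (finBelow Ltpd M u)).trans (residueChar_finBelow (F := Ltpd) u)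

/-- `p_u` of a prime `u` of `L` read through the tower is its residue characteristic. [claim: Joshi2024ATS4, status: disputed] -/
theorem charL_ofNumberFields (u : HeightOneSpectrum (𝓞 L)) :
    (ofNumberFields Lmod Ltpd M L L' S estar l).charL u = residueChar L u :=
  (charTpd_ofNumberFields Lmod Ltpd M L L' S estar l (finBelow Ltpd L u)).trans (residueChar_finBelow (F := Ltpd) u)

/-- **`p_w` of a prime `w` of `L′` read through the tower `L′ → M → L_tpd → L_mod` is `residueChar L′ w`** («p_v is also the
characteristic of the residue field of any prime of L′ lying over p», p.65 l.31). [claim: Joshi2024ATS4, status: disputed] -/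
theorem charW_ofNumberFields (w : HeightOneSpectrum (𝓞 L')) :
    (ofNumberFields Lmod Ltpd M L L' S estar l).charW w = residueChar L' w :=
  (charM_ofNumberFields Lmod Ltpd M L L' S estar l (finBelow M L' w)).trans (residueChar_finBelow (F := M) w)

/-- **`V^dst_ℚ` BY THE §6.6 DEFINITION, read at `ℚ`: `p ∈ V^dst_ℚ ⟺` some place `u` of `L′` over `p` is ramified over `ℚ`** —
VERBATIM the hypothesis `hT` of E-t24 gen 9's `vdstQFinset_eq_primeFactors_discr` / `TowerGlue.vdst_eq_reading3_iff_of_genuine`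
(p465152), now a theorem of the genuine tower (E-t31 `vdstQ_eq : V^dst_ℚ = charW '' Ramified`). [claim: Joshi2024ATS4, status: disputed] -/
theorem mem_vdstQ_ofNumberFields_iff (p : ℕ) :
    p ∈ (ofNumberFields Lmod Ltpd M L L' S estar l).VdstQ ↔
      ∃ u : HeightOneSpectrum (𝓞 L'), residueChar L' u = p ∧ 2 ≤ u.asIdeal.ramificationIdx ℤ := by
  rw [vdstQ_eq]
  constructor
  · rintro ⟨w, hw, rfl⟩
    exact ⟨w, (charW_ofNumberFields Lmod Ltpd M L L' S estar l w).symm, hw⟩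
  · rintro ⟨u, hu, hram⟩
    exact ⟨u, hram, (charW_ofNumberFields Lmod Ltpd M L L' S estar l u).trans hu⟩

/-- **Lemma 6.7.1 (1) ⟺ (2) ⟺ «p ∣ disc L′» at the genuine tower: `V^dst_ℚ = primeFactors(disc L′)` as finite sets** (Dedekind's
discriminant theorem; E-t24 gen 9's `vdstQFinset_eq_primeFactors_discr` with `hT` discharged). [claim: Joshi2024ATS4, status: disputed] -/
theorem vdstQFinset_ofNumberFields :
    (ofNumberFields Lmod Ltpd M L L' S estar l).vdstQFinset = (discr L').natAbs.primeFactors :=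
  vdstQFinset_eq_primeFactors_discr _ L' (mem_vdstQ_ofNumberFields_iff Lmod Ltpd M L L' S estar l)

/-- `p ∈ V^dst_ℚ ⟺ p` is a prime dividing `disc L′`. [cite: NeukirchANT1999, Ch. III (2.12)] -/
theorem mem_vdstQ_ofNumberFields_iff_dvd_discr (p : ℕ) :
    p ∈ (ofNumberFields Lmod Ltpd M L L' S estar l).VdstQ ↔ p.Prime ∧ (p : ℤ) ∣ discr L' := by
  rw [← mem_vdstQFinset, vdstQFinset_ofNumberFields, Nat.mem_primeFactors, Int.natCast_dvd]
  exact ⟨fun h => ⟨h.1, h.2.1⟩, fun h => ⟨h.1, h.2, Int.natAbs_ne_zero.mpr (discr_ne_zero L')⟩⟩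

/-- **(6.7.2)–(6.7.4) for `L* = ℚ` at the genuine tower: `log(s_ℚ) = Σ_{p ∣ disc L′} log p`** (`= log rad |disc L′|`).
[claim: Joshi2024ATS4, status: disputed] -/
theorem logSQ_ofNumberFields :
    (ofNumberFields Lmod Ltpd M L L' S estar l).logSQ = ∑ p ∈ (discr L').natAbs.primeFactors, Real.log p := by
  unfold logSQ
  rw [vdstQFinset_ofNumberFields]
  rfl

/-- **`V^dst_M` at the genuine tower**: `v ∈ V^dst_M ⟺` some place `w` of `L′` over `v` is ramified over `ℚ` (§6.6 p.60 l.58–62,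
verbatim). [claim: Joshi2024ATS4, status: disputed] -/
theorem mem_vdstM_ofNumberFields_iff (v : HeightOneSpectrum (𝓞 M)) :
    v ∈ (ofNumberFields Lmod Ltpd M L L' S estar l).VdstM ↔
      ∃ w : HeightOneSpectrum (𝓞 L'), finBelow M L' w = v ∧ 2 ≤ w.asIdeal.ramificationIdx ℤ :=
  ⟨fun ⟨w, hw, hwv⟩ => ⟨w, hwv, hw⟩, fun ⟨w, hwv, hw⟩ => ⟨w, hw, hwv⟩⟩

/-- **`V^dst_{L_tpd}` at the genuine tower** (the §6.6 definition with `M := L_tpd`; the route `L′ → M → L_tpd` collapsed by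
`finBelow_finBelow`): `u ∈ V^dst_{L_tpd} ⟺` some place of `L′` over `u` is ramified over `ℚ`. [claim: Joshi2024ATS4, status: disputed] -/
theorem mem_vdstTpd_ofNumberFields_iff (u : HeightOneSpectrum (𝓞 Ltpd)) :
    u ∈ (ofNumberFields Lmod Ltpd M L L' S estar l).VdstTpd ↔
      ∃ w : HeightOneSpectrum (𝓞 L'), finBelow Ltpd L' w = u ∧ 2 ≤ w.asIdeal.ramificationIdx ℤ := by
  constructor
  · rintro ⟨w, hw, hwu⟩
    exact ⟨w, (finBelow_finBelow Ltpd M L' w).symm.trans hwu, hw⟩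
  · rintro ⟨w, hwu, hw⟩
    exact ⟨w, hw, (finBelow_finBelow Ltpd M L' w).trans hwu⟩

/-- **`V^dst_{L_mod}` at the genuine tower** (§6.7 «the image of V^dst_{L_tpd} in V_{L_mod}», = E-t31 `vdstMod_eq`): `v ∈ V^dst_{L_mod}
⟺` some place of `L′` restricting to `v` (through `L_tpd`) is ramified over `ℚ`. [claim: Joshi2024ATS4, status: disputed] -/
theorem mem_vdstMod_ofNumberFields_iff (v : HeightOneSpectrum (𝓞 Lmod)) :
    v ∈ (ofNumberFields Lmod Ltpd M L L' S estar l).VdstMod ↔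
      ∃ w : HeightOneSpectrum (𝓞 L'), finBelow Lmod Ltpd (finBelow Ltpd L' w) = v ∧ 2 ≤ w.asIdeal.ramificationIdx ℤ := by
  rw [vdstMod_eq]
  constructor
  · rintro ⟨w, hw, hwv⟩
    refine ⟨w, ?_, hw⟩
    rw [← finBelow_finBelow Ltpd M L' w]
    exact hwv
  · rintro ⟨w, hwv, hw⟩
    refine ⟨w, hw, ?_⟩
    rw [← finBelow_finBelow Ltpd M L' w] at hwv
    exact hwv

/-- **The `Supp(q_M + d_M)`-slot read back**: `u ∈ Supp(q_M + d_M) ⟺ u|_{L_mod} ∈ S` (Def. 4.4.2, `S = Supp q_{L_mod}`) `∨ e(u|p_u) ≥ 2`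
(Supp of the absolute different (4.3.1) = ramified, Dedekind). [claim: Joshi2024ATS4, status: disputed] -/
theorem mem_suppM_ofNumberFields_iff (u : HeightOneSpectrum (𝓞 M)) :
    u ∈ (ofNumberFields Lmod Ltpd M L L' S estar l).suppM ↔
      finBelow Lmod Ltpd (finBelow Ltpd M u) ∈ S ∨ 2 ≤ u.asIdeal.ramificationIdx ℤ := by
  rw [← multiplicity_differentIdeal_pos_iff_two_le]
  exact Iff.rfl

/-- The `Supp(q_{L_tpd} + d_{L_tpd})`-slot read back (Def. 4.4.2 + (4.3.1), Dedekind). [claim: Joshi2024ATS4, status: disputed] -/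
theorem mem_suppTpd_ofNumberFields_iff (u : HeightOneSpectrum (𝓞 Ltpd)) :
    u ∈ (ofNumberFields Lmod Ltpd M L L' S estar l).suppTpd ↔ finBelow Lmod Ltpd u ∈ S ∨ 2 ≤ u.asIdeal.ramificationIdx ℤ := by
  rw [← multiplicity_differentIdeal_pos_iff_two_le]; exact Iff.rfl

/-- The `Supp(q_L + d_L)`-slot read back (Def. 4.4.2 + (4.3.1), Dedekind). [claim: Joshi2024ATS4, status: disputed] -/
theorem mem_suppL_ofNumberFields_iff (u : HeightOneSpectrum (𝓞 L)) :
    u ∈ (ofNumberFields Lmod Ltpd M L L' S estar l).suppL ↔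
      finBelow Lmod Ltpd (finBelow Ltpd L u) ∈ S ∨ 2 ≤ u.asIdeal.ramificationIdx ℤ := by
  rw [← multiplicity_differentIdeal_pos_iff_two_le]
  exact Iff.rfl

/-! ## 3. Lemma 6.6.1 at the genuine tower -/

/-- **The different-half of Lemma 6.6.1 (2) ⟹ (1), DERIVED**: a prime `v` of `M` ramified over `ℚ` lies in `V^dst_M` — every place `w`
of `L′` over `v` (going-up) has `e(w|p) = e(v|p)·e(w|v) ≥ 2`. (The `Supp q_M`-half and «p_v ∣ 30ℓ ⟹ (1)» are arithmetic of the curve /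
of `L′ ⊇ ℚ(ζ_{60ℓ})`, not tower facts — they stay with the reading predicate `Lem661₁₂`.) [cite: NeukirchANT1999, Ch. II (7.8)]
[claim: Joshi2024ATS4, status: disputed] -/
theorem mem_vdstM_ofNumberFields_of_two_le (v : HeightOneSpectrum (𝓞 M)) (hv : 2 ≤ v.asIdeal.ramificationIdx ℤ) :
    v ∈ (ofNumberFields Lmod Ltpd M L L' S estar l).VdstM := by
  obtain ⟨w, hw⟩ := PilotData.exists_finBelow_eq (K := L') v
  refine (mem_vdstM_ofNumberFields_iff Lmod Ltpd M L L' S estar l v).mpr ⟨w, hw, ?_⟩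
  haveI : w.asIdeal.IsMaximal := w.isMaximal
  have hunder : w.asIdeal.under (𝓞 M) = v.asIdeal := congrArg HeightOneSpectrum.asIdeal hw
  have hmul : w.asIdeal.ramificationIdx ℤ = (w.asIdeal.under (𝓞 M)).ramificationIdx ℤ * w.asIdeal.ramificationIdx (𝓞 M) :=
    Ideal.ramificationIdx_tower (R := ℤ) (w.asIdeal.under (𝓞 M)) w.asIdeal
  have hpos : 1 ≤ w.asIdeal.ramificationIdx (𝓞 M) := Ideal.ramificationIdx_pos w.asIdeal (𝓞 M)
  rw [hmul, hunder]
  nlinarith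

/-- **Lemma 6.6.1 (1) ⟺ (3) DERIVED at the genuine tower for `L′/L_tpd` Galois** (p.61 l.1–5: «v ∈ V^dst_M ⟺ the image of v in
V_{L_tpd} is contained in V^dst_{L_tpd}»). (1) ⟹ (3) is definitional (E-t31 `vdstM_sub`); (3) ⟹ (1): if `v|_{L_tpd}` lies under a
ramified `w ∈ 𝕍(L′)`, take any `w₁ ∈ 𝕍(L′)` over `v` (going-up); `w₁` and `w` lie over the same place of `L_tpd`, so — conjugate places
of the Galois extension `L′/L_tpd` ramifying together, tree `ramificationIdx_int_eq_of_finBelow_eq` — `e(w₁|p) = e(w|p) ≥ 2`. (In the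
standing set-up `L′ ↔ K` is Galois over `L_mod ↔ F_mod` — [IUTchI] Rmk. 3.1.5 under the cell's dictionary — whence over `L_tpd`;
nothing is claimed without the hypothesis.) The registry row J4:Lem6.6.1 carried (3) ⟹ (1) as a HYPOTHESIS over the signature.
[cite: NeukirchANT1999, Ch. I (9.3)]
[claim: Joshi2024ATS4, status: disputed] -/
theorem lem661₁₃_ofNumberFields [IsGalois Ltpd L'] : (ofNumberFields Lmod Ltpd M L L' S estar l).Lem661₁₃ := by
  intro v
  refine ⟨(ofNumberFields Lmod Ltpd M L L' S estar l).vdstM_sub v, ?_⟩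
  rintro ⟨w, hw, hwv⟩
  change 2 ≤ w.asIdeal.ramificationIdx ℤ at hw
  change finBelow Ltpd M (finBelow M L' w) = finBelow Ltpd M v at hwv
  obtain ⟨w₁, hw₁⟩ := PilotData.exists_finBelow_eq (K := L') v
  refine (mem_vdstM_ofNumberFields_iff Lmod Ltpd M L L' S estar l v).mpr ⟨w₁, hw₁, ?_⟩
  have h : finBelow Ltpd L' w₁ = finBelow Ltpd L' w := by
    rw [← finBelow_finBelow Ltpd M L' w₁, hw₁, ← finBelow_finBelow Ltpd M L' w]
    exact hwv.symm
  rw [ramificationIdx_int_eq_of_finBelow_eq w₁ w h]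
  exact hw

/-- Consequently, for `L′/L_tpd` Galois, **`V^dst_M` is the full inverse image of `V^dst_{L_tpd}`** in `𝕍(M)` (Lemma 6.6.1 (1) ⟺ (3)
as a set identity). [claim: Joshi2024ATS4, status: disputed] -/
theorem vdstM_ofNumberFields_eq_preimage [IsGalois Ltpd L'] :
    (ofNumberFields Lmod Ltpd M L L' S estar l).VdstM = finBelow Ltpd M ⁻¹' (ofNumberFields Lmod Ltpd M L L' S estar l).VdstTpd :=
  Set.ext fun v => lem661₁₃_ofNumberFields Lmod Ltpd M L L' S estar l v

/-! ## 4. The consumers, witness-free -/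

namespace TowerGlue

/-- **(6.8.11) = R-J row Y-21f for a carrier `TowerGlue`d to a GENUINE tower — E-t24's `eq6811_of_genuineTower` with `hc` and `hW`
DISCHARGED** (`hc` = `char_prime_ofNumberFields`; the witness of a ramified `w` is `w` itself, `charW_ofNumberFields`). Remaining
inputs, all BY NAME as in p453374: `L_mod ⊆ L_tpd` Galois; `S₀` = the places of `L_tpd` over `S = Supp q_{L_mod}` (`hS₀`); the
genuine readings of `d_mod`, `log d_{L_tpd}`, `log f_{L_tpd}`; the (D0) descent `hD0`. [claim: Joshi2024ATS4, status: disputed] -/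
theorem eq6811_ofNumberFields [IsGalois Lmod Ltpd] {d : LocusVolumeDatum}
    (G : TowerGlue (ofNumberFields Lmod Ltpd M L L' S estar l) d)
    (S₀ : Finset (HeightOneSpectrum (𝓞 Ltpd))) (hS₀ : ∀ w₀, w₀ ∈ S₀ ↔ finBelow Lmod Ltpd w₀ ∈ S)
    (hdmod : d.dmod = Module.finrank ℚ Lmod)
    (hdiff : d.logDiffTpd = ndeg Ltpd (differentDivisor Ltpd))
    (hcond : d.logCondTpd = ndeg Ltpd (ADivisor.reduced S₀))
    (hD0 : ∀ u : HeightOneSpectrum (𝓞 L'), 2 ≤ u.asIdeal.ramificationIdx ℤ → ¬ residueChar L' u ∣ 2 * 3 * 5 * d.l →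
      finBelow Ltpd L' u ∈ S₀ ∨ 2 ≤ (finBelow Ltpd L' u).asIdeal.ramificationIdx ℤ) :
    d.Eq6811 :=
  G.eq6811_of_genuineTower Lmod Ltpd L' (char_prime_ofNumberFields Lmod Ltpd M L L' S estar l)
    (fun w hw => ⟨w, (charW_ofNumberFields Lmod Ltpd M L L' S estar l w).symm, hw⟩) S S₀ hS₀ hdmod hdiff hcond hD0

/-- **E-t24 gen 9's `vdst_eq_primeFactors_discr` with `hT` DISCHARGED**: a carrier `TowerGlue`d to a genuine tower has
`V^dst_ℚ`-slot `dd.Vdst = primeFactors(disc L′)`. [claim: Joshi2024ATS4, status: disputed] -/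
theorem vdst_eq_primeFactors_discr_ofNumberFields {dd : LocusVolumeDatum}
    (GT : TowerGlue (ofNumberFields Lmod Ltpd M L L' S estar l) dd) :
    dd.Vdst = (discr L').natAbs.primeFactors :=
  GT.vdst_eq_primeFactors_discr L' (mem_vdstQ_ofNumberFields_iff Lmod Ltpd M L L' S estar l)

end TowerGlue

end Constructor

/-! ### E-t24 gen 9's theta-tower biconditional (rows Y-21c/e/f) with `hT` discharged -/

section ThetaTower

open Literature.IUT.LogVolume.Cor22
open Literature.NumberTheory.DiophantineGeometry Literature.NumberTheory.DiophantineGeometry.GenEll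
open Literature.NumberTheory.EllipticCurves

variable {P : NFPoint} {F : Type} [Field F] [NumberField F] [Algebra P.F F]
  (Lmod Ltpd M L K : Type) [Field Lmod] [NumberField Lmod] [Field Ltpd] [NumberField Ltpd]
  [Field M] [NumberField M] [Field L] [NumberField L] [Field K] [NumberField K]
  [Algebra Lmod Ltpd] [Algebra Ltpd M] [Algebra M K] [Algebra Ltpd L] [Algebra L K] [Algebra Ltpd K]
  [IsScalarTower Ltpd M K] [IsScalarTower Ltpd L K]
  [Algebra F K] [Algebra P.F K] [IsScalarTower P.F F K]
  (S : Finset (HeightOneSpectrum (𝓞 Lmod))) (estar : ℕ) (ψ : K →ₐ[F] AlgebraicClosure F) {ℓ : ℕ}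

/-- **The genuine-tower residual of rows Y-21c/e/f (E-t24 gen 9 `TowerGlue.vdst_eq_reading3_iff_of_genuine`, p465152) with its
genuine-reading hypothesis `hT` DISCHARGED**: for `λ ∈ U`, `F` a theta field, `K ⊇ F` Galois inside `F(E_F[ℓ])`, `ℓ` prime, and a
carrier `dd` under E-t31's `TowerGlue` to the genuine tower with top field `L′ = K` (any `L_mod ⊆ L_tpd ⊆ M ⊆ K`, `L_tpd ⊆ L ⊆ K`):
p460339's reading-(3) equation `dd.Vdst = primeFactors(30ℓ) ∪ p(Supp 𝔮_{F_tpd}) ∪ primeFactors(disc F_tpd)` HOLDS IFF (i) «every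
prime dividing `2·3·5·ℓ` divides `disc K`» AND (ii) «every bad place of `λ` away from `{2, ℓ}` lies under a place of `K` ramified over
`ℚ`». A biconditional; neither clause asserted. [claim: Joshi2024ATS4, status: disputed] -/
theorem TowerGlue.vdst_eq_reading3_iff_ofNumberFields (hU : P.InU) (hF : IsThetaField P F) [IsGalois F K] (hℓ : ℓ.Prime)
    (hK : letI := thetaCurve_isElliptic hU F
      ((thetaCurve P F).galoisRepTorsion (ℓ : ℤ)).ker ≤ ψ.fieldRange.fixingSubgroup)
    {dd : LocusVolumeDatum} (GT : PrimeTowerDatum.TowerGlue (ofNumberFields Lmod Ltpd M L K S estar ℓ) dd) :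
    dd.Vdst = (2 * 3 * 5 * ℓ).primeFactors ∪ (TateDivisorDatum.ofNFPoint P {2, ℓ}).V.image (residueChar P.F) ∪
        (discr P.F).natAbs.primeFactors ↔
      (∀ p ∈ (2 * 3 * 5 * ℓ).primeFactors, p ∈ (discr K).natAbs.primeFactors) ∧
        ∀ v ∈ (TateDivisorDatum.ofNFPoint P {2, ℓ}).V,
          ∃ u : HeightOneSpectrum (𝓞 K), residueChar K u = residueChar P.F v ∧ 2 ≤ u.asIdeal.ramificationIdx ℤ :=
  GT.vdst_eq_reading3_iff_of_genuine ψ hU hF hℓ hK (mem_vdstQ_ofNumberFields_iff Lmod Ltpd M L K S estar ℓ)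

end ThetaTower

/-! ## 5. Smoke test: the constructor elaborates at the trivial tower -/

/-- At the trivial tower `ℚ = L_mod = L_tpd = M = L = L′` the genuine `V^dst_ℚ` is EMPTY (`disc ℚ = 1` has no prime factor) — the
constructor elaborates against Mathlib's instances; a smoke test of the definition, nothing of any curve. [folklore] -/
theorem vdstQFinset_ofNumberFields_rat (S : Finset (HeightOneSpectrum (𝓞 ℚ))) (estar l : ℕ) :
    (ofNumberFields ℚ ℚ ℚ ℚ ℚ S estar l).vdstQFinset = ∅ := by
  rw [vdstQFinset_ofNumberFields, Rat.numberField_discr, Int.natAbs_one, Nat.primeFactors_one]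

end PrimeTowerDatum

end Summit.ABC.IUTFork.Joshi.ATS4

end
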